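import Mathlib
import Literature.NumberTheory.Automorphic.EichlerOrderLocalGlobal
import Literature.NumberTheory.Automorphic.JordanZassenhaus
import Literature.NumberTheory.Automorphic.BrandtModuleDictionary
import HarnessLib

/-!
# Orders of `M₂(ℚ)`: every `ℤ`-order is contained in a conjugate of `M₂(ℤ)`, and the maximal
# orders are exactly the conjugates `g M₂(ℤ) g⁻¹`, `g ∈ GL₂(ℚ)`

Topic `NumberTheory/Automorphic`; theorems only (no definition, no named fact, no instance). The
classical description of the orders of the split quaternion algebra `M₂(ℚ)` (Vignéras, LNM 800,
Ch. II §2 Lemme 2.1 / Ch. I §4 for `K = ℚ`: "les ordres maximaux de `M(2,K)` sont les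
`End(L)`, `L` un réseau complet de `K²`"; Voight, *Quaternion Algebras*, 10.5.1–10.5.5 over a
PID), proved with bare hands over `ℤ`:

1. `exists_gl_mem_iff_of_lattice` — a full `ℤ`-lattice `L ⊆ ℚ²` (`ℤ² ⊆ L`, `N L ⊆ ℤ²`) is
   `g ℤ²` for some `g ∈ GL₂(ℚ)` (Hermite normal form: `L` is spanned by `(a/N, b/N)` and
   `(0, d/N)` where `aℤ`, `dℤ` are the ideals of first coordinates and of second coordinates of
   vectors with vanishing first coordinate).
2. `Brandt.IsOrder.exists_le_map_unitsConj_matrixOrder` — every `ℤ`-order `O` of `M₂(ℚ)` (tree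
   `Brandt.IsOrder`) lies in `g M₂(ℤ) g⁻¹` (`(matrixOrder ℤ ℚ).map (unitsConj g)`, tree) for some
   `g ∈ GL₂(ℚ)`: take the `O`-stable lattice `L = O ℤ²` and 1.
3. `isOrder_map_unitsConj_matrixOrder`, `Brandt.IsMaximalOrder.exists_eq_map_unitsConj_matrixOrder`
   — hence a maximal order IS such a conjugate.

This is brick "S2b" of the `D = 1` branch of the proof of the named fact
`Literature.NumberTheory.Automorphic.ShimuraCurveData.volume_fd_eq` (Eichler orders of level `M`
of `M₂(ℚ)` are conjugate to `(ℤ ℤ; Mℤ ℤ)`, next file). The tree's order theory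
(`MaximalOrdersLocallyConjugate`, `EichlerOrderLocalConjugacy`) is for DIVISION algebras
(`hdiv`), which excludes `M₂(ℚ)`; the split case is done here globally and elementarily.

## References

* M.-F. Vignéras, *Arithmétique des algèbres de quaternions*, LNM 800 (1980), Ch. II §2
  Lemme 2.1 and Ch. III §5 [VignerasLNM800].
* J. Voight, *Quaternion Algebras*, GTM 288 (2021), Lemma 10.5.1–Cor. 10.5.5 [Voight2021].
-/

noncomputable section

open Matrix

namespace Literature.NumberTheory.Automorphic

local notation "Mat" => Matrix (Fin 2) (Fin 2) ℚ

/-! ### 1. Full `ℤ`-lattices of `ℚ²` are `g ℤ²` -/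

section Lattice

/-- `g (m₀, m₁) = m₀ • (column 0) + m₁ • (column 1)` for a `2 × 2` matrix. [folklore] -/
theorem mulVec_fin_two_eq (g : Mat) (m : Fin 2 → ℚ) :
    g *ᵥ m = m 0 • (fun i => g i 0) + m 1 • (fun i => g i 1) := by
  funext i
  simp [Matrix.mulVec, dotProduct, Fin.sum_univ_two, mul_comm]

/-- **Hermite normal form of a full lattice of `ℚ²`.** Let `L ⊆ ℚ²` be a `ℤ`-submodule with
`ℤ² ⊆ L` and `N L ⊆ ℤ²` for some integer `N ≠ 0`. Then `L = g ℤ²` for some `g ∈ GL₂(ℚ)`: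
`w ∈ L ↔ g⁻¹ w ∈ ℤ²`. [folklore] -/
theorem exists_gl_mem_iff_of_lattice (L : Submodule ℤ (Fin 2 → ℚ))
    (hZ : ∀ v : Fin 2 → ℤ, (fun i => (v i : ℚ)) ∈ L)
    {N : ℤ} (hN : N ≠ 0) (hNL : ∀ w ∈ L, ∀ i, ∃ n : ℤ, (N : ℚ) * w i = n) :
    ∃ g : GL (Fin 2) ℚ, ∀ w : Fin 2 → ℚ,
      w ∈ L ↔ ∀ i, ∃ n : ℤ, (((g⁻¹ : GL (Fin 2) ℚ) : Mat) *ᵥ w) i = n := by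
  have hNq : (N : ℚ) ≠ 0 := Int.cast_ne_zero.mpr hN
  -- the ideal of first coordinates
  let I₁ : Ideal ℤ :=
    { carrier := {n | ∃ w ∈ L, (N : ℚ) * w 0 = n}
      add_mem' := by
        rintro x y ⟨w, hw, hx⟩ ⟨w', hw', hy⟩
        refine ⟨w + w', add_mem hw hw', ?_⟩
        simp only [Pi.add_apply, mul_add, hx, hy, Int.cast_add]
      zero_mem' := ⟨0, zero_mem _, by simp⟩
      smul_mem' := by
        rintro c x ⟨w, hw, hx⟩
        refine ⟨c • w, L.smul_mem c hw, ?_⟩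
        simp only [Pi.smul_apply, zsmul_eq_mul, smul_eq_mul, Int.cast_mul, ← hx]
        ring }
  -- the ideal of second coordinates of vectors with vanishing first coordinate
  let I₂ : Ideal ℤ :=
    { carrier := {n | ∃ w ∈ L, w 0 = 0 ∧ (N : ℚ) * w 1 = n}
      add_mem' := by
        rintro x y ⟨w, hw, hw0, hx⟩ ⟨w', hw', hw'0, hy⟩
        refine ⟨w + w', add_mem hw hw', by simp [hw0, hw'0], ?_⟩
        simp only [Pi.add_apply, mul_add, hx, hy, Int.cast_add]
      zero_mem' := ⟨0, zero_mem _, rfl, by simp⟩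
      smul_mem' := by
        rintro c x ⟨w, hw, hw0, hx⟩
        refine ⟨c • w, L.smul_mem c hw, by simp [hw0], ?_⟩
        simp only [Pi.smul_apply, zsmul_eq_mul, smul_eq_mul, Int.cast_mul, ← hx]
        ring }
  have hI₁ : I₁.IsPrincipal := IsPrincipalIdealRing.principal I₁
  have hI₂ : I₂.IsPrincipal := IsPrincipalIdealRing.principal I₂
  set a : ℤ := Submodule.IsPrincipal.generator I₁ with ha
  set d : ℤ := Submodule.IsPrincipal.generator I₂ with hd
  obtain ⟨w₁, hw₁L, hw₁⟩ : a ∈ I₁ := Submodule.IsPrincipal.generator_mem I₁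
  obtain ⟨w₂, hw₂L, hw₂0, hw₂⟩ : d ∈ I₂ := Submodule.IsPrincipal.generator_mem I₂
  have hmem₁ : ∀ {x : ℤ}, x ∈ I₁ → ∃ s : ℤ, x = s * a := fun hx => by
    obtain ⟨s, hs⟩ := (Submodule.IsPrincipal.mem_iff_eq_smul_generator I₁).mp hx
    exact ⟨s, by rw [hs, smul_eq_mul]⟩
  have hmem₂ : ∀ {x : ℤ}, x ∈ I₂ → ∃ s : ℤ, x = s * d := fun hx => by
    obtain ⟨s, hs⟩ := (Submodule.IsPrincipal.mem_iff_eq_smul_generator I₂).mp hx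
    exact ⟨s, by rw [hs, smul_eq_mul]⟩
  -- `a ≠ 0`, `d ≠ 0` (the unit vectors lie in `L`)
  have ha0 : a ≠ 0 := by
    have hN1 : N ∈ I₁ :=
      ⟨fun i => ((Pi.single (0 : Fin 2) (1 : ℤ) : Fin 2 → ℤ) i : ℚ), hZ _, by simp⟩
    obtain ⟨s, hs⟩ := hmem₁ hN1
    intro h
    rw [h, mul_zero] at hs
    exact hN hs
  have hd0 : d ≠ 0 := by
    have hN2 : N ∈ I₂ :=
      ⟨fun i => ((Pi.single (1 : Fin 2) (1 : ℤ) : Fin 2 → ℤ) i : ℚ), hZ _, by simp, by simp⟩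
    obtain ⟨s, hs⟩ := hmem₂ hN2
    intro h
    rw [h, mul_zero] at hs
    exact hN hs
  -- `L = ℤ w₁ + ℤ w₂`
  have hspan : ∀ w : Fin 2 → ℚ, w ∈ L ↔ ∃ m₁ m₂ : ℤ, w = m₁ • w₁ + m₂ • w₂ := by
    intro w
    constructor
    · intro hw
      obtain ⟨m₁, hm₁⟩ := hmem₁ (⟨w, hw, (hNL w hw 0).choose_spec⟩ : _ ∈ I₁)
      have hx0 : (N : ℚ) * w 0 = m₁ * a := by
        rw [(hNL w hw 0).choose_spec, hm₁]
        push_cast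
        ring
      set w' := w - m₁ • w₁ with hw'
      have hw'L : w' ∈ L := sub_mem hw (L.smul_mem m₁ hw₁L)
      have hw'0 : w' 0 = 0 := by
        have e : w' 0 = w 0 - m₁ * w₁ 0 := by
          simp only [hw', Pi.sub_apply, Pi.smul_apply]
          rw [zsmul_eq_mul]
        have : (N : ℚ) * w' 0 = 0 := by
          rw [e, mul_sub, hx0, mul_left_comm, hw₁]
          ring
        rcases mul_eq_zero.mp this with h | h
        · exact absurd h hNq
        · exact h
      obtain ⟨m₂, hm₂⟩ := hmem₂ (⟨w', hw'L, hw'0, (hNL w' hw'L 1).choose_spec⟩ : _ ∈ I₂)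
      have hx1 : (N : ℚ) * w' 1 = m₂ * d := by
        rw [(hNL w' hw'L 1).choose_spec, hm₂]
        push_cast
        ring
      refine ⟨m₁, m₂, ?_⟩
      have hw'' : w' - m₂ • w₂ = 0 := by
        funext i
        fin_cases i
        · simp only [Pi.sub_apply, Pi.smul_apply, Pi.zero_apply]
          simp [hw'0, hw₂0]
        · have : (N : ℚ) * (w' 1 - m₂ * w₂ 1) = 0 := by
            rw [mul_sub, hx1, mul_left_comm, hw₂]
            ring
          rcases mul_eq_zero.mp this with h | h
          · exact absurd h hNq
          · simp only [Pi.sub_apply, Pi.smul_apply, Pi.zero_apply]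
            rw [zsmul_eq_mul]
            exact h
      have : w = w' + m₁ • w₁ := by rw [hw', sub_add_cancel]
      rw [this, ← sub_eq_zero]
      rw [← hw'']
      abel
    · rintro ⟨m₁, m₂, rfl⟩
      exact add_mem (L.smul_mem m₁ hw₁L) (L.smul_mem m₂ hw₂L)
  -- the matrix with columns `w₁, w₂`
  set g₀ : Mat := Matrix.of fun i j => if j = 0 then w₁ i else w₂ i with hg₀
  have hw₁0 : w₁ 0 = a / N := by field_simp; rw [mul_comm]; exact hw₁
  have hw₂1 : w₂ 1 = d / N := by field_simp; rw [mul_comm]; exact hw₂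
  have hdet : g₀.det ≠ 0 := by
    rw [Matrix.det_fin_two]
    simp only [hg₀, of_apply, if_true, Fin.one_eq_zero_iff, OfNat.ofNat_ne_one, if_false, hw₂0,
      zero_mul, sub_zero, hw₁0, hw₂1]
    have ha' : (a : ℚ) ≠ 0 := Int.cast_ne_zero.mpr ha0
    have hd' : (d : ℚ) ≠ 0 := Int.cast_ne_zero.mpr hd0
    exact mul_ne_zero (div_ne_zero ha' hNq) (div_ne_zero hd' hNq)
  have hunit : IsUnit g₀ := (Matrix.isUnit_iff_isUnit_det _).mpr (isUnit_iff_ne_zero.mpr hdet)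
  have hg₀v : ∀ m : Fin 2 → ℚ, g₀ *ᵥ m = m 0 • w₁ + m 1 • w₂ := by
    intro m
    rw [mulVec_fin_two_eq]
    simp only [hg₀, of_apply, if_true, Fin.one_eq_zero_iff, OfNat.ofNat_ne_one, if_false]
  refine ⟨hunit.unit, fun w => ?_⟩
  have hcoe : ((hunit.unit⁻¹ : GL (Fin 2) ℚ) : Mat) = g₀⁻¹ := by
    rw [Matrix.coe_units_inv, IsUnit.unit_spec]
  rw [hcoe, hspan]
  constructor
  · rintro ⟨m₁, m₂, rfl⟩
    have : g₀⁻¹ *ᵥ (m₁ • w₁ + m₂ • w₂) = ![(m₁ : ℚ), m₂] := by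
      have e : m₁ • w₁ + m₂ • w₂ = g₀ *ᵥ ![(m₁ : ℚ), m₂] := by
        rw [hg₀v]; simp [zsmul_eq_mul, Pi.smul_def]
      rw [e, mulVec_mulVec, Matrix.nonsing_inv_mul _ (isUnit_iff_ne_zero.mpr hdet), one_mulVec]
    intro i
    rw [this]
    fin_cases i
    · exact ⟨m₁, rfl⟩
    · exact ⟨m₂, rfl⟩
  · intro h
    obtain ⟨n₀, hn₀⟩ := h 0
    obtain ⟨n₁, hn₁⟩ := h 1
    refine ⟨n₀, n₁, ?_⟩
    have e : w = g₀ *ᵥ (g₀⁻¹ *ᵥ w) := by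
      rw [mulVec_mulVec, Matrix.mul_nonsing_inv _ (isUnit_iff_ne_zero.mpr hdet), one_mulVec]
    rw [e, hg₀v, hn₀, hn₁]
    simp [zsmul_eq_mul, Pi.smul_def]

end Lattice

/-! ### 2. Orders of `M₂(ℚ)` -/

section Orders

/-- Every rational has a nonzero integral multiple in `ℤ` (the denominator hypothesis of
`isFullLattice_matrixOrder` for `ℤ ⊆ ℚ`). [folklore] -/
theorem rat_exists_zsmul_mem_range (k : ℚ) :
    ∃ n : ℤ, n ≠ 0 ∧ n • k ∈ (algebraMap ℤ ℚ).range := by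
  refine ⟨k.den, by exact_mod_cast k.den_ne_zero, k.num, ?_⟩
  rw [zsmul_eq_mul, eq_intCast, Int.cast_natCast, Rat.den_mul_eq_num]

/-- `M₂(ℤ) ⊆ M₂(ℚ)` is a `ℤ`-order. [folklore] -/
theorem isZOrder_matrixOrder_rat : IsZOrder (matrixOrder ℤ ℚ : Submodule ℤ Mat) :=
  ⟨one_mem_matrixOrder, fun _ ha _ hb => mul_mem_matrixOrder ha hb,
    isFullLattice_matrixOrder rat_exists_zsmul_mem_range⟩

/-- The conjugates `g M₂(ℤ) g⁻¹`, `g ∈ GL₂(ℚ)`, are `ℤ`-orders (tree `Brandt.IsOrder`). [folklore] -/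
theorem isOrder_map_unitsConj_matrixOrder (g : Matˣ) :
    Brandt.IsOrder Mat ((matrixOrder ℤ ℚ : Submodule ℤ Mat).map (unitsConj g : Mat →ₗ[ℤ] Mat)) :=
  isZOrder_iff_isOrder.mp (isZOrder_matrixOrder_rat.map_unitsConj g)

/-- An entry of `A` is a coordinate of `A` applied to a unit vector. [folklore] -/
theorem apply_eq_mulVec_single (A : Mat) (i j : Fin 2) :
    A i j = (A *ᵥ Pi.single j 1) i := by
  rw [mulVec_single_one, col_apply]

/-- **Every `ℤ`-order of `M₂(ℚ)` lies in a conjugate of `M₂(ℤ)`**: for `O ⊆ M₂(ℚ)` an order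
(full `ℤ`-lattice, `1 ∈ O`, `O O ⊆ O`) there is `g ∈ GL₂(ℚ)` with `g⁻¹ O g ⊆ M₂(ℤ)` — namely
`O ⊆ End(L)` for the `O`-stable full lattice `L = O ℤ² = g ℤ²` (Vignéras II §2 Lemme 2.1).
[cite: VignerasLNM800, Ch. II §2 Lemme 2.1] -/
theorem Brandt.IsOrder.exists_le_map_unitsConj_matrixOrder {O : Submodule ℤ Mat}
    (hO : Brandt.IsOrder Mat O) :
    ∃ g : Matˣ, O ≤ (matrixOrder ℤ ℚ : Submodule ℤ Mat).map (unitsConj g : Mat →ₗ[ℤ] Mat) := by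
  -- the lattice `L = O ℤ²`
  let S : Set (Fin 2 → ℚ) := {v | ∃ x ∈ O, ∃ m : Fin 2 → ℤ, v = x *ᵥ fun i => (m i : ℚ)}
  let L : Submodule ℤ (Fin 2 → ℚ) := Submodule.span ℤ S
  have hZ : ∀ v : Fin 2 → ℤ, (fun i => (v i : ℚ)) ∈ L := fun v =>
    Submodule.subset_span ⟨1, hO.one_mem, v, by rw [one_mulVec]⟩
  -- `L` is `O`-stable
  have hstab : ∀ x ∈ O, ∀ v ∈ L, x *ᵥ v ∈ L := by
    intro x hx v hv
    induction hv using Submodule.span_induction with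
    | mem v hv =>
      obtain ⟨y, hy, m, rfl⟩ := hv
      exact Submodule.subset_span ⟨x * y, hO.mul_mem x hx y hy, m, by rw [mulVec_mulVec]⟩
    | zero => rw [mulVec_zero]; exact zero_mem _
    | add v w _ _ hv hw => rw [mulVec_add]; exact add_mem hv hw
    | smul c v _ hv =>
      have : x *ᵥ (c • v) = c • (x *ᵥ v) := by
        rw [zsmul_eq_mul, zsmul_eq_mul]
        have : ((c : ℤ) : (Fin 2 → ℚ)) * v = (c : ℚ) • v := by
          funext i; simp
        rw [this, mulVec_smul]
        funext i; simp
      rw [this]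
      exact L.smul_mem c hv
  -- a common denominator: `N O ⊆ M₂(ℤ)`, hence `N L ⊆ ℤ²`
  obtain ⟨N, hN, hNO⟩ := exists_smul_mem_of_fg
    (isFullLattice_matrixOrder (R := ℤ) (K := ℚ) rat_exists_zsmul_mem_range) hO.isFullLattice.1
  have hNL : ∀ w ∈ L, ∀ i, ∃ n : ℤ, (N : ℚ) * w i = n := by
    intro w hw
    induction hw using Submodule.span_induction with
    | mem v hv =>
      obtain ⟨y, hy, m, rfl⟩ := hv
      intro i
      have hNy : ∀ i j, ∃ n : ℤ, (N : ℚ) * y i j = n := fun i j => by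
        obtain ⟨n, hn⟩ := mem_matrixOrder_iff.mp (hNO y hy) i j
        refine ⟨n, ?_⟩
        rw [eq_intCast] at hn
        rw [hn, Matrix.smul_apply, zsmul_eq_mul]
      obtain ⟨n₀, hn₀⟩ := hNy i 0
      obtain ⟨n₁, hn₁⟩ := hNy i 1
      refine ⟨n₀ * m 0 + n₁ * m 1, ?_⟩
      simp only [mulVec, dotProduct, Fin.sum_univ_two, mul_add, ← mul_assoc, hn₀, hn₁]
      push_cast
      ring
    | zero => intro i; exact ⟨0, by simp⟩
    | add v w _ _ hv hw =>
      intro i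
      obtain ⟨n, hn⟩ := hv i
      obtain ⟨n', hn'⟩ := hw i
      exact ⟨n + n', by simp [mul_add, hn, hn']⟩
    | smul c v _ hv =>
      intro i
      obtain ⟨n, hn⟩ := hv i
      refine ⟨c * n, ?_⟩
      simp only [Pi.smul_apply, zsmul_eq_mul, Int.cast_mul, ← hn]
      ring
  -- `L = g ℤ²`
  obtain ⟨g, hg⟩ := exists_gl_mem_iff_of_lattice L hZ hN hNL
  refine ⟨g, fun x hx => ?_⟩
  rw [mem_map_unitsConj_iff, mem_matrixOrder_iff]
  intro i j
  -- column `j` of `g⁻¹ x g` is `g⁻¹ (x (g e_j))`, and `g e_j ∈ L`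
  have hgej : (g : Mat) *ᵥ Pi.single j 1 ∈ L := by
    rw [hg]
    intro k
    rw [mulVec_mulVec, Units.inv_mul, one_mulVec]
    refine ⟨(Pi.single j (1 : ℤ) : Fin 2 → ℤ) k, ?_⟩
    rcases eq_or_ne k j with rfl | h
    · simp
    · simp [h]
  have hmem := hstab x hx _ hgej
  rw [hg] at hmem
  obtain ⟨n, hn⟩ := hmem i
  refine ⟨n, ?_⟩
  rw [eq_intCast, ← hn, mulVec_mulVec, mulVec_mulVec, mulVec_single_one]
  rfl

/-- **The maximal orders of `M₂(ℚ)` are the conjugates of `M₂(ℤ)`**: a maximal `ℤ`-order `O` of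
`M₂(ℚ)` (tree `Brandt.IsMaximalOrder`) equals `g M₂(ℤ) g⁻¹` for some `g ∈ GL₂(ℚ)` (it lies in
such a conjugate, which is an order). [cite: VignerasLNM800, Ch. II §2 Lemme 2.1] -/
theorem Brandt.IsMaximalOrder.exists_eq_map_unitsConj_matrixOrder {O : Submodule ℤ Mat}
    (hO : Brandt.IsMaximalOrder Mat O) :
    ∃ g : Matˣ, O = (matrixOrder ℤ ℚ : Submodule ℤ Mat).map (unitsConj g : Mat →ₗ[ℤ] Mat) := by
  obtain ⟨g, hle⟩ := hO.1.exists_le_map_unitsConj_matrixOrder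
  exact ⟨g, (hO.2 _ (isOrder_map_unitsConj_matrixOrder g) hle).symm⟩

end Orders

end Literature.NumberTheory.Automorphic

end
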